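import Summits.QuantumFields.YangMills.Theorems.CheckerboardTrialityHyperoctahedralRung
import Summits.QuantumFields.YangMills.Theorems.BalabanLadderROTUVExtract
import Summits.QuantumFields.YangMills.Theses.CheckerboardTriality
import HarnessLib

/-!
# Route `CheckerboardTriality` (rung R2d `BalabanLadder.ROT`), crux `TrialityOnCheckerboardCells` (stmt-QuantumFields-22666):
# the registered stub `stub_cellHyperoctahedral` of line «coset» holds MODULO the sibling crux `CheckerboardCoverTransfer`

Helper file (`--supports stmt-QuantumFields-22666 --as helper`; planner ym-idea-1 g8's line «coset», 2026-08-28T17:24:02Z; seat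
`ym-line-fcl-p3` g13, free hands).  Definition-free, 0 sorry, standard axioms.  No item is closed; no summit, no crux and no mass gap
is proved by this file (R2d is a RECORD rung).

WHAT IS PROVED.
* §1 `isSignedPerm_of_mapsTo_lattice` — a linear isometry of `ℝ⁴` mapping `ℤ⁴` into `ℤ⁴` is a signed permutation of the axes
  (`IsSignedPerm`): `R eᵢ` is an integer vector of norm one.
* §2 `latticeDist_linActMulti_sub_tendsto_zero` — STRAIGHT-torus, distribution level, along the WHOLE scheme: under
  `MomentBounds6 G r a` and UV sequential compactness off the diagonal (`UVCompactAt r a`, supplied by ✓`ROT.stub_uvExtract`), for every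
  admissible leg scheme, every signed permutation `R`, `n ≥ 2` and `F ∈ ⁰𝒮ₙ`:
  `latticeDist_k(R·F) − latticeDist_k(F) → 0` (subsequence principle `tendsto_of_subseq_tendsto` + the W(B₄) rung of K1 on limit
  points, ✓`CheckerboardTrialityHyperoctahedral.signedPerm_invariant_of_offDiagLimitAlong`, p650192).
* §3 ★ `cellHyperoctahedral_of_coverTransfer : CheckerboardCoverTransfer → (signature of stub_cellHyperoctahedral, verbatim)` — transfer
  `F` and `R·F` (King's class is `linActMulti`-stable) from the checkerboard cell to the straight torus by C2 and use §2.  So the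
  planner may set `stub_cellHyperoctahedral := cellHyperoctahedral_of_coverTransfer ‹C2›` once 22667 lands.
* §4 consequence: `trialityOnCheckerboardCells_of_coverTransfer_of_coset` (C1 ⇐ C2 ∧ coset stub, the skeleton's composition with
  stub 1 discharged by §3); with the landed glue ✓`checkerboardTriality_trialityLimit_of_cells` (p648490) and
  ✓`checkerboardTriality_checkerboardCellsExist_proof` (p648430) this gives K1 22566 ⇐ C2 ∧ coset stub (one line, not restated here to
  keep this file out of the glue modules' import cone): the open content of LINE g8-B is EXACTLY {`CheckerboardCoverTransfer` 22667,
  `stub_cellTrialityCoset`}.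

WHY NOT UNCONDITIONALLY (the honest reading of «provable now»).  Every axis flip maps the corner-based composite
`r.curvature.F = Σ_{i<j} P^{ij}_x` to `Σ_{p∌μ} P^p_{θx} + Σ_{p∋μ} P^p_{θx−e_μ}` (tree: `HypercubicLimit.Negative.torusDensity_timeReflect`) on
EVERY lattice, skew cells included; so for the reflection half of `W(B₄)` the cell defect is an `O(a_k)` shift defect, not `0`, and its
vanishing needs `a`-uniform moment bounds of the CHECKERBOARD-CELL Wilson theory — which `MomentBounds6` (straight torus, `torusE`) does
not supply and the stub's hypotheses do not contain.  Only the `S₄` half is exact on the cell (and even that needs compact support and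
`a_k L_k → ∞`, the transversal `box ∪ (box + (2L_k+1)e₃)` not being permutation invariant).  Modulo C2 — which the split
`TrialityLimitOfCells` consumes anyway — both halves are free, and that is what this file records.

References: K. Osterwalder, R. Schrader, CMP 31 (1973) §2; J. Glimm, A. Jaffe, Quantum Physics (1987) §6.1; J. H. Conway,
N. J. A. Sloane, SPLAG (1999) Ch. 4 §7.1.
-/

set_option autoImplicit false

noncomputable section

open scoped SchwartzMap BigOperators
open MeasureTheory Filter Topology
open Literature.MathematicalPhysics.QuantumFieldTheory Literature.MathematicalPhysics.QuantumLattice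
open Literature.MathematicalPhysics.AQFT
open Literature.Probability.LatticeModels (Site box)
open Summit.QuantumFields.YangMills.Cruxes.OSLegsFromFemtoAndGap.DlrCollarTransfer (MomentBounds6)
open Summit.QuantumFields.YangMills.Cruxes.OSLegsAtWeakCouplingC.Sketch (IsSignedPerm)
open Summit.QuantumFields.YangMills.Cruxes.OSLegsAtWeakCouplingC.Y2Bridge (King.linActMulti_mem_kingClass)
open Summit.QuantumFields.YangMills.Theorems.OSLegsFromFemtoAndGap (latticeDist)
open Summit.QuantumFields.YangMills.Theorems.ROT (IsLegScheme OffDiagLimitAlong UVCompactAt PeriodCell)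
open Summit.QuantumFields.YangMills.Theorems.NPointIsotropy.Negative (E4)
open Summit.QuantumFields.YangMills.Theorems.CheckerboardTrialityHyperoctahedral (signedPerm_invariant_of_offDiagLimitAlong)
open Summit.QuantumFields.YangMills.Theses.CheckerboardTriality (TrialityOnCheckerboardCells CheckerboardCoverTransfer)

namespace Summit.QuantumFields.YangMills.Theorems.CheckerboardTrialityCellHyperoctahedral

/-! ## §1 `ℤ⁴`-preserving linear isometries of `ℝ⁴` are signed permutations -/

/-- `siteToE (Pi.single i 1) = eᵢ`. [folklore] -/
theorem siteToE_single (i : Fin 4) : siteToE (Pi.single i (1 : ℤ) : Site 4) = EuclideanSpace.single i (1 : ℝ) := by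
  ext j
  rw [siteToE_apply, PiLp.single_apply, Pi.single_apply]
  split_ifs <;> simp

/-- An integer vector of `ℤ⁴` of Euclidean norm one is `± eⱼ`. [folklore] -/
theorem siteToE_eq_single_of_norm_eq_one (w : Site 4) (hw : ‖siteToE w‖ = 1) :
    ∃ j : Fin 4, siteToE w = EuclideanSpace.single j (1 : ℝ) ∨ siteToE w = -EuclideanSpace.single j (1 : ℝ) := by
  -- `Σ (w i)² = 1` in `ℤ`
  have hsq : ∑ i : Fin 4, (w i) ^ 2 = 1 := by
    have h := EuclideanSpace.norm_sq_eq (siteToE w)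
    rw [hw, one_pow] at h
    have h' : ((∑ i : Fin 4, (w i) ^ 2 : ℤ) : ℝ) = 1 := by
      rw [h]; push_cast
      refine Finset.sum_congr rfl fun i _ => ?_
      rw [siteToE_apply, Real.norm_eq_abs, sq_abs]
    exact_mod_cast h'
  -- one coordinate is non-zero …
  obtain ⟨j, -, hj⟩ : ∃ j ∈ (Finset.univ : Finset (Fin 4)), (w j) ^ 2 ≠ 0 := by
    by_contra h
    push Not at h
    rw [Finset.sum_eq_zero h] at hsq
    exact zero_ne_one hsq
  have hj' : w j ≠ 0 := fun h => hj (by rw [h]; ring)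
  -- … and then all the others vanish and `w j = ±1`
  have hsplit := Finset.add_sum_erase (Finset.univ : Finset (Fin 4)) (fun i => (w i) ^ 2) (Finset.mem_univ j)
  have hone : 1 ≤ (w j) ^ 2 := by
    have := Int.one_le_abs hj'
    nlinarith [abs_nonneg (w j), sq_abs (w j)]
  have hrest0 : ∑ i ∈ Finset.univ.erase j, (w i) ^ 2 = 0 := by
    have hnn : 0 ≤ ∑ i ∈ Finset.univ.erase j, (w i) ^ 2 := Finset.sum_nonneg fun i _ => sq_nonneg _
    linarith
  have hrest : ∀ i, i ≠ j → w i = 0 := by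
    intro i hi
    have h := (Finset.sum_eq_zero_iff_of_nonneg fun k _ => sq_nonneg (w k)).1 hrest0 i
      (Finset.mem_erase.2 ⟨hi, Finset.mem_univ i⟩)
    exact pow_eq_zero_iff (n := 2) (by norm_num) |>.1 h
  have hwj : (w j) ^ 2 = 1 := by linarith
  have hwj' : w j = 1 ∨ w j = -1 := Int.eq_one_or_neg_one_of_mul_eq_one (by rw [← sq]; exact hwj)
  refine ⟨j, ?_⟩
  rcases hwj' with h1 | h1
  · left
    ext k
    rw [siteToE_apply, PiLp.single_apply]
    by_cases hk : k = j
    · subst hk; simp [h1]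
    · simp [hk, hrest k hk]
  · right
    ext k
    rw [siteToE_apply, PiLp.neg_apply, PiLp.single_apply]
    by_cases hk : k = j
    · subst hk; simp [h1]
    · simp [hk, hrest k hk]

/-- **A linear isometry of `ℝ⁴` mapping the integer lattice `ℤ⁴` into itself is a signed permutation of the axes**
(`R eᵢ = ± e_j`): `R eᵢ ∈ ℤ⁴` has norm one. [cite: ConwaySloane1999, Ch. 4 §7.1] -/
theorem isSignedPerm_of_mapsTo_lattice (R : E4 ≃ₗᵢ[ℝ] E4)
    (hR : ∀ z : Fin 4 → ℤ, ∃ w : Fin 4 → ℤ, R (siteToE z) = siteToE w) : IsSignedPerm R := by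
  intro i
  obtain ⟨w, hw⟩ := hR (Pi.single i 1)
  rw [siteToE_single] at hw
  have hnorm : ‖siteToE w‖ = 1 := by
    rw [← hw, LinearIsometryEquiv.norm_map, PiLp.norm_single, norm_one]
  obtain ⟨j, hj⟩ := siteToE_eq_single_of_norm_eq_one w hnorm
  exact ⟨j, by rw [hw]; exact hj⟩

/-! ## §2 Straight torus, distribution level: the signed-permutation defect dies along the whole scheme -/

variable {G : Type} [Group G] [TopologicalSpace G] [IsTopologicalGroup G] [CompactSpace G]
  [MeasurableSpace G] [BorelSpace G]

/-- **`latticeDist_k(R·F) − latticeDist_k(F) → 0` along every admissible leg scheme, for every signed permutation `R`, `n ≥ 2`,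
`F ∈ ⁰𝒮ₙ`**, under `MomentBounds6` and UV sequential compactness off the diagonal.  Subsequence principle: every subsequence has a
further one with an off-diagonal limit `S₁` (`UVCompactAt`), along which both sequences converge, to `S₁ n (R·F)` and `S₁ n F`, and
these agree by the `W(B₄)` rung on limit points (`signedPerm_invariant_of_offDiagLimitAlong`). [cite: OS1973, §2] [cite: GlimmJaffe1987, §6.1] -/
theorem latticeDist_linActMulti_sub_tendsto_zero (r : LatticeRep G) {a : ℝ → ℝ} (hapos : ∀ β, 0 < a β)
    (ha0 : Tendsto a atTop (𝓝 0)) (hMB : MomentBounds6 G r a) (hUV : UVCompactAt r a)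
    {sch : SpeciesScheme (YMSpecies G)} (hsch : IsLegScheme a sch)
    (R : E4 ≃ₗᵢ[ℝ] E4) (hR : IsSignedPerm R) {n : ℕ} (hn : 2 ≤ n) (F : 𝓢((Fin n → E4), ℂ)) (hF : IsOffDiagonal F) :
    Tendsto (fun k => latticeDist r.ρ (sch.β k) (sch.L k) (sch.a k) r.curvature.F
        (wilsonTorusMean r.ρ (sch.β k) (sch.L k) r.curvature.F) n (linActMulti R F) -
      latticeDist r.ρ (sch.β k) (sch.L k) (sch.a k) r.curvature.F
        (wilsonTorusMean r.ρ (sch.β k) (sch.L k) r.curvature.F) n F) atTop (𝓝 0) := by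
  refine tendsto_of_subseq_tendsto fun ns hns => ?_
  obtain ⟨ψ, hψ, S₁, hS₁⟩ := hUV sch hsch ns hns
  refine ⟨ψ, ?_⟩
  have hφ : Tendsto (ns ∘ ψ) atTop atTop := hns.comp hψ.tendsto_atTop
  have hinv : S₁ n (linActMulti R F) = S₁ n F :=
    signedPerm_invariant_of_offDiagLimitAlong r hapos ha0 hMB hsch hφ hS₁ R hR n F hF
  have limF := hS₁.2.2 n hn F hF
  have limRF := hS₁.2.2 n hn (linActMulti R F) (hF.linActMulti R)
  have h := limRF.sub limF
  rw [hinv, sub_self] at h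
  exact h

/-! ## §3 ★ The cell stub modulo the cover transfer -/

/-- ★ **`stub_cellHyperoctahedral` of line «coset» (crux `TrialityOnCheckerboardCells`, stmt-QuantumFields-22666) holds MODULO
`CheckerboardCoverTransfer` (stmt-QuantumFields-22667)** — conclusion = the registered stub signature verbatim: for `R` preserving `ℤ⁴`
the checkerboard-cell rotation defect on King's class tends to zero along the scheme.  Proof: `R` is a signed permutation (§1); C2
transfers `F` and `R·F` (still in King's class) to the straight tori; there the defect dies (§2, with `UVCompactAt` from
✓`ROT.stub_uvExtract`); `cell(R·F) − cell(F) = [cell(R·F) − tor(R·F)] + [tor(R·F) − tor(F)] − [cell(F) − tor(F)]`. [cite: OS1973, §2] -/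
theorem cellHyperoctahedral_of_coverTransfer (h₂ : CheckerboardCoverTransfer) :
    open Literature.MathematicalPhysics.QuantumFieldTheory Literature.MathematicalPhysics.QuantumLattice Literature.MathematicalPhysics.AQFT Literature.Probability.LatticeModels Summit.QuantumFields.YangMills.Cruxes.OSLegsFromFemtoAndGap.DlrCollarTransfer Summit.QuantumFields.YangMills.Cruxes.OSLegsAtWeakCouplingC.Sketch Summit.QuantumFields.YangMills.Cruxes.OSLegsAtWeakCouplingC.Y2Bridge Summit.QuantumFields.YangMills.Theorems.ROT in ∀ (G : Type) [Group G] [TopologicalSpace G] [IsTopologicalGroup G] [CompactSpace G], IsCompactSimpleLieGroup G → letI : MeasurableSpace G := borel G; haveI : BorelSpace G := ⟨rfl⟩; ∀ (r : LatticeRep G) (a : ℝ → ℝ), (∀ β, 0 < a β) → Tendsto a atTop (nhds 0) → MomentBounds6 G r a → ∀ sch : SpeciesScheme (YMSpecies G), IsLegScheme a sch → ∀ C : ℕ → PeriodCell 4, (∀ k, ((C k).P : Set (Fin 4 → ℤ)) = {z | ∃ w : Fin 4 → ℤ, Even (∑ i, w i) ∧ z = ((2 * sch.L k + 1 : ℕ)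 : ℤ) • w} ∧ box 4 (sch.L k) ⊆ (C k).reps) → ∀ r₀ : ℝ, ∀ (n : ℕ), 2 ≤ n → ∀ F ∈ King.KingClass n r₀, ∀ R : EuclideanSpace ℝ (Fin 4) ≃ₗᵢ[ℝ] EuclideanSpace ℝ (Fin 4), (∀ z : Fin 4 → ℤ, ∃ w : Fin 4 → ℤ, R (siteToE z) = siteToE w) → Tendsto (fun k => (C k).dist r.ρ (sch.β k) (fun z => (sch.a k) • siteToE z) r.curvature.F ((C k).mean r.ρ (sch.β k) r.curvature.F) n (linActMulti R F) - (C k).dist r.ρ (sch.β k) (fun z => (sch.a k) • siteToE z) r.curvature.F ((C k).mean r.ρ (sch.β k) r.curvature.F) n F) atTop (nhds 0) := by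
  unfold Summit.QuantumFields.YangMills.Theses.CheckerboardTriality.CheckerboardCoverTransfer at h₂
  intro G _ _ _ _ hG
  letI : MeasurableSpace G := borel G
  haveI : BorelSpace G := ⟨rfl⟩
  intro r a ha ha0 hMB sch hsch C hC r₀ n hn F hF R hZ
  have hR : IsSignedPerm R := isSignedPerm_of_mapsTo_lattice R hZ
  have hUV : UVCompactAt r a := ROT.stub_uvExtract G hG r a ha ha0 hMB
  have H₂ := h₂ G hG r a ha ha0 hMB sch hsch C hC
  have hRF := King.linActMulti_mem_kingClass hF R
  -- the three vanishing differences
  have d₂ := H₂ n hn F hF.1 hF.2.1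
  have d₃ := H₂ n hn _ hRF.1 hRF.2.1
  have dT := latticeDist_linActMulti_sub_tendsto_zero r ha ha0 hMB hUV hsch R hR hn F hF.1
  have key := (d₃.add dT).sub d₂
  simp only [add_zero, sub_zero] at key
  exact key.congr fun k => by ring

/-! ## §4 Consequences: the line «coset» and K1 modulo C2 and the coset stub -/

/-- **C1 ⇐ C2 ∧ (coset stub)**: with `stub_cellHyperoctahedral` discharged by §3, the skeleton's composition `TrialityOnCheckerboardCells_of`
(case split on `R(ℤ⁴) = ℤ⁴`; germ radius from the coset stub) gives `TrialityOnCheckerboardCells` from `CheckerboardCoverTransfer` and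
the coset stub (its registered signature, verbatim, as a hypothesis). [folklore] -/
theorem trialityOnCheckerboardCells_of_coverTransfer_of_coset (h₂ : CheckerboardCoverTransfer)
    (hcoset : open Literature.MathematicalPhysics.QuantumFieldTheory Literature.MathematicalPhysics.QuantumLattice Literature.MathematicalPhysics.AQFT Literature.Probability.LatticeModels Summit.QuantumFields.YangMills.Cruxes.OSLegsFromFemtoAndGap.DlrCollarTransfer Summit.QuantumFields.YangMills.Cruxes.OSLegsAtWeakCouplingC.Sketch Summit.QuantumFields.YangMills.Cruxes.OSLegsAtWeakCouplingC.Y2Bridge Summit.QuantumFields.YangMills.Theorems.ROT in ∀ (G : Type) [Group G] [TopologicalSpace G] [IsTopologicalGroup G] [CompactSpace G], IsCompactSimpleLieGroup G → letI : MeasurableSpace G := borel G; haveI : BorelSpace G := ⟨rfl⟩; ∀ (r : LatticeRep G) (a : ℝ → ℝ), (∀ β, 0 < a β) → Tendsto a atTop (nhds 0) → MomentBounds6 G r a → ∀ sch : SpeciesScheme (YMSpecies G), IsLegScheme a sch → ∀ C : ℕ → PeriodCell 4, (∀ k, ((C k).P : Set (Fin 4 → ℤ)) = {z | ∃ w : Fin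 4 → ℤ, Even (∑ i, w i) ∧ z = ((2 * sch.L k + 1 : ℕ) : ℤ) • w} ∧ box 4 (sch.L k) ⊆ (C k).reps) → ∃ r₀ : ℝ, 0 < r₀ ∧ ∀ (n : ℕ), 2 ≤ n → ∀ F ∈ King.KingClass n r₀, ∀ R : EuclideanSpace ℝ (Fin 4) ≃ₗᵢ[ℝ] EuclideanSpace ℝ (Fin 4), (∀ z : Fin 4 → ℤ, Even (∑ i, z i) → ∃ w : Fin 4 → ℤ, Even (∑ i, w i) ∧ R (siteToE z) = siteToE w) → (¬ ∀ z : Fin 4 → ℤ, ∃ w : Fin 4 → ℤ, R (siteToE z) = siteToE w) → Tendsto (fun k => (C k).dist r.ρ (sch.β k) (fun z => (sch.a k) • siteToE z) r.curvature.F ((C k).mean r.ρ (sch.β k) r.curvature.F) n (linActMulti R F) - (C k).dist r.ρ (sch.β k) (fun z => (sch.a k) • siteToE z) r.curvature.F ((C k).mean r.ρ (sch.β k) r.curvature.F) n F) atTop (nhds 0)) :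
    TrialityOnCheckerboardCells := by
  unfold Summit.QuantumFields.YangMills.Theses.CheckerboardTriality.TrialityOnCheckerboardCells
  intro G _ _ _ _ hG
  letI : MeasurableSpace G := borel G
  haveI : BorelSpace G := ⟨rfl⟩
  intro r a ha ha0 hM sch hsch C hC
  obtain ⟨r₀, hr₀, hb⟩ := hcoset G hG r a ha ha0 hM sch hsch C hC
  refine ⟨r₀, hr₀, fun n hn F hF R hR => ?_⟩
  by_cases hZ : ∀ z : Fin 4 → ℤ, ∃ w : Fin 4 → ℤ, R (siteToE z) = siteToE w
  · exact cellHyperoctahedral_of_coverTransfer h₂ G hG r a ha ha0 hM sch hsch C hC r₀ n hn F hF R hZ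
  · exact hb n hn F hF R hR hZ

end Summit.QuantumFields.YangMills.Theorems.CheckerboardTrialityCellHyperoctahedral

end
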